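import Mathlib
import HarnessLib
import Literature.Analysis.FluidPDE.TypeIAncientMild
import Literature.Analysis.FluidPDE.VorticityCalculus
import Literature.Analysis.FluidPDE.AxisymHouLiVariables
import Summits.NavierStokesRegularity.NavierStokesRegularity.Theorems.PoloidalWindowDoorPoloidalWindowRigidityWindow
import Summits.NavierStokesRegularity.NavierStokesRegularity.Theorems.PoloidalWindowDoorPoloidalWindowRigidityFirstIntegral

/-!
# Route `PoloidalWindowDoor`, crux `PoloidalWindowRigidity` (K2, stmt-NavierStokesRegularity-19708) —
# LOOP-TANGENCY PIN: the horizontal vorticity vanishes at an ISOLATED thread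

Cell ns-regularity-ideate, seat ns-poloidal-K2-p2 g11 (stub-worker on K2; `--supports` the crux item).
This file proves VERBATIM the shared stub **P1 `stub_loopTangencyPin`** of the ideator lines
`Cruxes/PoloidalWindowRigidity/Lines/thread_type.lean` (ns-idea-8 g5, v2) and
`Cruxes/PoloidalWindowRigidity/Lines/centre_type.lean` (ns-idea-8 g6), critic price P11-1.

STATEMENT.  For a profile of the route's Type-I class (rate, continuity on the open slab, Oseen-mild,
divergence-free slices) which is poloidal (`ω₂ = ⟪curl v(s), e₂⟫ ≡ 0`), hot-spot normalised at `(−1,0)`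
(`√(−t)|v₂(t,x)| ≤ |v₂(−1,0)|`), and whose hot spot is an ISOLATED horizontal critical point of
`y ↦ v₂(−1,y)` on the plane `{y₂ = 0}`, the vertical shear of the horizontal velocity vanishes at the hot
spot: `∂_z v₀(−1,0) = ∂_z v₁(−1,0) = 0` — equivalently `ωₕ(−1,0) = 0`, since `∇v₂(−1,0) = 0`.

PROOF (as sketched in the line card).  The frozen law of the poloidal stratum
(`…PoloidalWindowRigidityFirstIntegral.stub_firstIntegral`: `⟪Dv(s,y)·ω(s,y), e₂⟫ = 0`) says that `v₂(−1,·)`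
is a first integral of the smooth vorticity field `ω(−1,·) = curl v(−1,·)`, and `ω₂ ≡ 0` says that this
field is horizontal.  If `ω(−1,0) ≠ 0`, the integral curve `c` of `ω(−1,·)` through `0` (Mathlib's `C¹`
Picard–Lindelöf, `ContDiffAt.exists_forall_mem_closedBall_exists_eq_forall_mem_Ioo_hasDerivAt₀`) stays in
the plane `{y₂ = 0}` and keeps `v₂(−1,c(τ)) = v₂(−1,0)`; by the hot-spot normalisation at `t = −1` every
`c(τ)` is then a global extremum of `v₂(−1,·)`, hence a critical point (Fermat), and `c(τ) ≠ 0` for small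
`τ ≠ 0` (`HasDerivAt.eventually_ne`) — contradicting isolation.  So `ω(−1,0) = 0`, and with
`∇v₂(−1,0) = 0` (Fermat at the hot spot) the two curl components give `∂_z v₁ = ∂₁v₂ − ω₀ = 0` and
`∂_z v₀ = ω₁ + ∂₀v₂ = 0` at `(−1,0)`.

* `fderiv_eq_zero_of_abs_le` — Fermat for a point where `|g|` is globally maximal (no differentiability needed);
* `apply_integralCurve_eq` — a differentiable first integral is constant along an integral curve on `Ioo (−ε) ε`;
* `stub_loopTangencyPin` — the stub, VERBATIM.

WHAT THIS IS NOT: not a claim about Navier–Stokes regularity, not K2, not item 20428 — a kinematic pin at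
the hot spot of a HYPOTHETICAL poloidal Type-I blow-up profile (one provable stub of an ideator line;
bears_on LADDER-NS N0, rung N0-LocalTubeDoorPoloidal).
-/

noncomputable section

-- the summit and its single sub-problem share the name (CONVENTIONS §1), as in every Theorems file
set_option linter.dupNamespace false

namespace Summit.NavierStokesRegularity.NavierStokesRegularity.Theorems.PoloidalWindowDoorPoloidalWindowRigidityLoopTangencyPin

open MeasureTheory Set Function Filter Topology Metric
open scoped RealInnerProductSpace InnerProductSpace
open Literature.Analysis Literature.Analysis.FluidPDE
open Summit.NavierStokesRegularity.NavierStokesRegularity.Theorems.PoloidalWindowDoorPoloidalWindowRigidityWindow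
open Summit.NavierStokesRegularity.NavierStokesRegularity.Theorems.PoloidalWindowDoorPoloidalWindowRigidityFirstIntegral

/-! ### Two calculus helpers -/

/-- **Fermat at a point of maximal modulus.**  If `|g y| ≤ |g x|` for every `y`, then `fderiv ℝ g x = 0`:
`x` is a global maximum of `g` (if `g x > 0`), a global minimum (if `g x < 0`), or `g ≡ 0`.  No
differentiability is assumed (`fderiv` is `0` at a non-differentiable point). -/
theorem fderiv_eq_zero_of_abs_le {E : Type*} [NormedAddCommGroup E] [NormedSpace ℝ E]
    {g : E → ℝ} {x : E} (h : ∀ y, |g y| ≤ |g x|) : fderiv ℝ g x = 0 := by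
  rcases lt_trichotomy (g x) 0 with hneg | hzero | hpos
  · apply IsLocalMin.fderiv_eq_zero
    filter_upwards with y
    have h1 := h y
    rw [abs_of_neg hneg] at h1
    linarith [neg_abs_le (g y)]
  · have hg : ∀ y, g y = 0 := fun y => by
      have h1 := h y
      rw [hzero, abs_zero] at h1
      exact abs_nonpos_iff.1 h1
    have hfun : g = fun _ => (0 : ℝ) := funext hg
    rw [hfun]
    simp
  · apply IsLocalMax.fderiv_eq_zero
    filter_upwards with y
    have h1 := h y
    rw [abs_of_pos hpos] at h1
    linarith [le_abs_self (g y)]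

/-- **A first integral is constant along an integral curve.**  If `c` solves `c' = X(c)` on `Ioo (−ε) ε`
and `φ` is differentiable with `Dφ(y)(X y) = 0` for all `y`, then `φ (c t) = φ (c 0)` for `t ∈ Ioo (−ε) ε`. -/
theorem apply_integralCurve_eq {E : Type*} [NormedAddCommGroup E] [NormedSpace ℝ E]
    {X : E → E} {c : ℝ → E} {ε : ℝ} (hc : ∀ t ∈ Ioo (-ε) ε, HasDerivAt c (X (c t)) t)
    {φ : E → ℝ} (hφ : Differentiable ℝ φ) (hφX : ∀ y, fderiv ℝ φ y (X y) = 0)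
    {t : ℝ} (ht : t ∈ Ioo (-ε) ε) : φ (c t) = φ (c 0) := by
  have h0 : (0 : ℝ) ∈ Ioo (-ε) ε := ⟨by linarith [ht.1, ht.2], by linarith [ht.1, ht.2]⟩
  have hd : ∀ s ∈ Ioo (-ε) ε, HasDerivAt (φ ∘ c) 0 s := fun s hs => by
    have h := (hφ (c s)).hasFDerivAt.comp_hasDerivAt s (hc s hs)
    rwa [hφX] at h
  exact isOpen_Ioo.is_const_of_deriv_eq_zero isPreconnected_Ioo
    (fun s hs => (hd s hs).differentiableAt.differentiableWithinAt)
    (fun s hs => (hd s hs).deriv) ht h0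

/-! ### The stub -/

/-- **STUB P1 `stub_loopTangencyPin` (VERBATIM, lines thread_type v2 / centre_type of crux
`PoloidalWindowRigidity`): LOOP-TANGENCY PIN — the horizontal vorticity vanishes at an isolated thread.**
Class profile, poloidal, hot spot at `(−1,0)` (`√(−t)|v₂| ≤ |v₂(−1,0)|`), and the hot spot is an ISOLATED
horizontal critical point of `y ↦ v₂(−1,(y₀,y₁,0))`.  Then `∂_z v₀(−1,0) = ∂_z v₁(−1,0) = 0`.  Proof: frozen
law (`stub_firstIntegral`) + horizontality of `curl v(−1,·)` + the integral curve of `curl v(−1,·)` through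
the hot spot (Picard–Lindelöf) consists of global extrema of `v₂(−1,·)`, hence of horizontal critical points,
distinct from `0` for small non-zero times — contradicting isolation unless `curl v(−1,0) = 0`; then
`∇v₂(−1,0) = 0` (Fermat) converts `ω₀ = ω₁ = 0` into the two shear pins. -/
theorem stub_loopTangencyPin :
    ∀ (C : ℝ) (v : ℝ → EuclideanSpace ℝ (Fin 3) → EuclideanSpace ℝ (Fin 3)),
      Literature.Analysis.FluidPDE.HasTypeITimeDecay C v →
      ContinuousOn (Function.uncurry v) (Set.Iio (0 : ℝ) ×ˢ Set.univ) →
      (∀ s t : ℝ, s < t → t < 0 → ∀ x, v t x =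
        Literature.Analysis.UnboundedOperators.heatExtension (v s) (t - s) x -
          Literature.Analysis.FluidPDE.oseenDuhamel 1 s v v t x) →
      (∀ t < 0, Literature.Analysis.FluidPDE.VectorCalculus.IsDivFree (v t)) →
      (∀ s < 0, ∀ y, ⟪Literature.Analysis.FluidPDE.curl (v s) y, EuclideanSpace.single 2 1⟫_ℝ = 0) →
      v (-1) 0 2 ≠ 0 → (∀ t < 0, ∀ x, Real.sqrt (-t) * |v t x 2| ≤ |v (-1) 0 2|) →
      (∃ δ : ℝ, 0 < δ ∧ ∀ y : EuclideanSpace ℝ (Fin 3), y 2 = 0 → y ≠ 0 → ‖y‖ < δ →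
          (fderiv ℝ (v (-1)) y (EuclideanSpace.single 0 1) 2 ≠ 0 ∨ fderiv ℝ (v (-1)) y (EuclideanSpace.single 1 1) 2 ≠ 0)) →
      (fderiv ℝ (v (-1)) 0 (EuclideanSpace.single 2 1) 0 = 0 ∧ fderiv ℝ (v (-1)) 0 (EuclideanSpace.single 2 1) 1 = 0) := by
  intro C v hrate hcont hmild hdiv hpol _hV hsup hiso
  obtain ⟨δ, hδ, hiso⟩ := hiso
  -- smoothness of the slice `v(-1)` and of its curl
  have hA : IsTypeIAncientMild C v := isTypeIAncientMild_of_class hrate hcont hmild hdiv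
  have hvs : ContDiff ℝ (⊤ : ℕ∞) (v (-1)) := hA.contDiff_slice (by norm_num)
  have hv2 : ContDiff ℝ 2 (v (-1)) := contDiff_infty.1 hvs 2
  have hω1 : ContDiff ℝ 1 (curl (v (-1))) := contDiff_curl (n := 1) (by exact_mod_cast hv2)
  have hvd : Differentiable ℝ (v (-1)) := hv2.differentiable two_ne_zero
  -- the hot-spot normalisation at `t = -1`: `|v₂(-1,y)| ≤ |v₂(-1,0)|`
  have hext : ∀ y, |v (-1) y 2| ≤ |v (-1) 0 2| := fun y => by
    have h := hsup (-1) (by norm_num) y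
    simpa using h
  -- the frozen law at `s = -1`: `(Dv(-1,y) ω(-1,y))₂ = 0`
  have hfrozen : ∀ y, fderiv ℝ (v (-1)) y (curl (v (-1)) y) 2 = 0 := fun y => by
    have h := stub_firstIntegral C v hrate hcont hmild hdiv (EuclideanSpace.single 2 1) hpol (-1)
      (by norm_num) y
    simpa [EuclideanSpace.inner_single_right] using h
  -- poloidality at `s = -1`: `ω₂(-1,y) = 0`
  have hpol1 : ∀ y, curl (v (-1)) y 2 = 0 := fun y => by
    have h := hpol (-1) (by norm_num) y
    simpa [EuclideanSpace.inner_single_right] using h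
  -- Fermat: the gradient of `v₂(-1,·)` vanishes wherever `|v₂(-1,·)|` is maximal
  have hgrad : ∀ y, |v (-1) y 2| = |v (-1) 0 2| →
      ∀ h : EuclideanSpace ℝ (Fin 3), fderiv ℝ (v (-1)) y h 2 = 0 := by
    intro y hy h
    have hle : ∀ z, |(fun z => v (-1) z 2) z| ≤ |(fun z => v (-1) z 2) y| := fun z => by
      simp only [hy]
      exact hext z
    have h0 := fderiv_eq_zero_of_abs_le hle
    rw [← fderiv_apply_coord_vec3 (hvd y) 2 h, h0]
    simp
  -- MAIN CLAIM: the vorticity vanishes at the hot spot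
  have hcurl0 : curl (v (-1)) 0 = 0 := by
    by_contra hne
    -- the integral curve of `curl v(-1,·)` through `0`
    obtain ⟨c, hc0, ε, hε, hc⟩ :=
      (hω1.contDiffAt (x := (0 : EuclideanSpace ℝ (Fin 3)))).exists_forall_mem_closedBall_exists_eq_forall_mem_Ioo_hasDerivAt₀ 0
    have hc' : ∀ t ∈ Ioo (-ε) ε, HasDerivAt c (curl (v (-1)) (c t)) t := fun t ht =>
      hc t (by simpa using ht)
    have h0ε : (0 : ℝ) ∈ Ioo (-ε) ε := ⟨by linarith, hε⟩
    -- the curve stays in the plane `{y₂ = 0}`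
    have hc2 : ∀ t ∈ Ioo (-ε) ε, c t 2 = 0 := fun t ht => by
      have hφ : Differentiable ℝ (⇑(EuclideanSpace.proj (𝕜 := ℝ) (2 : Fin 3))) :=
        (EuclideanSpace.proj (𝕜 := ℝ) (2 : Fin 3)).differentiable
      have hφX : ∀ y, fderiv ℝ (⇑(EuclideanSpace.proj (𝕜 := ℝ) (2 : Fin 3))) y (curl (v (-1)) y) = 0 :=
        fun y => by
          rw [(EuclideanSpace.proj (𝕜 := ℝ) (2 : Fin 3)).fderiv]
          simpa using hpol1 y
      have h := apply_integralCurve_eq hc' hφ hφX ht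
      rw [hc0] at h
      simpa using h
    -- `v₂(-1,·)` is constant along the curve
    have hcv : ∀ t ∈ Ioo (-ε) ε, v (-1) (c t) 2 = v (-1) 0 2 := fun t ht => by
      have hφ : Differentiable ℝ (fun y => v (-1) y 2) :=
        (contDiff_apply_coord_vec3 hv2 2).differentiable two_ne_zero
      have hφX : ∀ y, fderiv ℝ (fun y => v (-1) y 2) y (curl (v (-1)) y) = 0 := fun y => by
        rw [fderiv_apply_coord_vec3 (hvd y) 2]
        exact hfrozen y
      have h := apply_integralCurve_eq hc' hφ hφX ht
      rwa [hc0] at h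
    -- for small `t ≠ 0`: `c t ≠ 0`, `‖c t‖ < δ`, `t ∈ Ioo (-ε) ε`
    have h1 : ∀ᶠ t in 𝓝[≠] (0 : ℝ), c t ≠ 0 :=
      (hc' 0 h0ε).eventually_ne (by rw [hc0]; exact hne)
    have h2 : ∀ᶠ t in 𝓝 (0 : ℝ), ‖c t‖ < δ := by
      have hca : ContinuousAt c 0 := (hc' 0 h0ε).continuousAt
      have h : ∀ᶠ t in 𝓝 (0 : ℝ), c t ∈ ball (0 : EuclideanSpace ℝ (Fin 3)) δ :=
        hca.preimage_mem_nhds (by rw [hc0]; exact ball_mem_nhds _ hδ)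
      filter_upwards [h] with t ht
      simpa using ht
    have h3 : ∀ᶠ t in 𝓝 (0 : ℝ), t ∈ Ioo (-ε) ε := Ioo_mem_nhds (by linarith) hε
    obtain ⟨t, ht1, ht2, ht3⟩ := (h1.and ((h2.and h3).filter_mono nhdsWithin_le_nhds)).exists
    -- the curve point `c t` is a horizontal critical point in the punctured `δ`-ball: contradiction
    have hy : |v (-1) (c t) 2| = |v (-1) 0 2| := by rw [hcv t ht3]
    rcases hiso (c t) (hc2 t ht3) ht1 ht2 with h | h
    · exact h (hgrad (c t) hy _)
    · exact h (hgrad (c t) hy _)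
  -- conclusion: `ω₀(-1,0) = ω₁(-1,0) = 0` and `∇v₂(-1,0) = 0` give the two shear pins
  have hg0 : ∀ h : EuclideanSpace ℝ (Fin 3), fderiv ℝ (v (-1)) 0 h 2 = 0 := hgrad 0 rfl
  have e0 : fderiv ℝ (v (-1)) 0 (EuclideanSpace.single 1 1) 2 =
      fderiv ℝ (v (-1)) 0 (EuclideanSpace.single 2 1) 1 := by
    have h : curl (v (-1)) 0 0 = 0 := by simp [hcurl0]
    simpa [curl, sub_eq_zero] using h
  have e1 : fderiv ℝ (v (-1)) 0 (EuclideanSpace.single 2 1) 0 =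
      fderiv ℝ (v (-1)) 0 (EuclideanSpace.single 0 1) 2 := by
    have h : curl (v (-1)) 0 1 = 0 := by simp [hcurl0]
    simpa [curl, sub_eq_zero] using h
  refine ⟨?_, ?_⟩
  · rw [e1]; exact hg0 _
  · rw [← e0]; exact hg0 _

end Summit.NavierStokesRegularity.NavierStokesRegularity.Theorems.PoloidalWindowDoorPoloidalWindowRigidityLoopTangencyPin

end
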